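import Summits.CriticalPhenomena.PercolationContinuityZ3.Theorems.PercNearOneGluingNoHeavyLowerTailThreePointVarianceTwoNeighbourCore
import Mathlib.Analysis.Calculus.LocalExtr.Basic
import Mathlib.Analysis.Calculus.Deriv.Mul
import Mathlib.Analysis.Calculus.Deriv.Add
import Mathlib.Topology.Order.Compact
import Mathlib.Tactic.Linarith
import Mathlib.Tactic.Ring
import HarnessLib

/-!
# The two-neighbour reduction for `(3PT)` — the maximum principle `FP₀(2)` on the square

Support file for crux `stmt-CriticalPhenomena-4575` (`NoHeavyLowerTail`), seat `prim-l12-p1` gen 18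
(`--supports stmt-CriticalPhenomena-4575`).  Memo `run/shared/lean/prim/prim-l12/FROM-prim-l12-p1-g18-FACET-PRINCIPLE.md` §4.6.

Continuation of `…ThreePointVarianceTwoNeighbourCore`.  For the cube polynomial of a two-edge star at `c`,
`N(r,ρ) = Θ(1−Θ) − Υ`, `Θ = θ₀ + π rρ`, `Υ = θ₀ + α r + β ρ + γ₂ rρ`, with coefficients coming from a state law
(`θ₀ = p₀+p₁+p₂+p₁₂`, `α = u₁+u₁₂+π−p₁−p₁₂`, `β = u₂+u₁₂+π−p₂−p₁₂`, `γ₂ = p₁₂−u₁₂−2π`, all masses `≥ 0` of total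
`≤ 1`), THIS FILE proves the maximum principle at level `0`:

* `fp0_two`: if `N ≤ 0` on the boundary of `[0,1]²` then `N ≤ 0` on `[0,1]²`.

Proof: a maximiser on the compact square (extreme value theorem) is either on the boundary or an interior critical
point (Fermat, `IsLocalMax.hasDerivAt_eq_zero` along the two coordinate lines), where `fp0_two_core` applies: the
critical value is `≤ 0` or `≤ N(1, rρ) ≤ 0`.  Since `−N(r,ρ)` is the `(3PT)` margin of `G = H + c` (edges `cv, cw` of
weights `r, ρ`) and the four sides of the square are the graphs `G−cw, G−cv, G/cv, G/cw`, this is the analytic half of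
the two-neighbour reduction (the graph-side identification of the coefficients is the remaining half). [this work]
-/

namespace Summit.CriticalPhenomena.PercolationContinuityZ3.Theorems.ThreePointVarianceTwoNeighbourCube

open Set Filter Topology
open Summit.CriticalPhenomena.PercolationContinuityZ3.Theorems.ThreePointVarianceTwoNeighbourCore

/-- Derivative of the cube polynomial along the first coordinate:
`∂_r N(r,ρ) = πρ(1 − 2(θ₀ + πrρ)) − α − γ₂ρ`. [this work] -/
theorem hasDerivAt_fst (θ₀ π α β γ₂ ρ r : ℝ) :
    HasDerivAt (fun t : ℝ => (θ₀ + π * t * ρ) * (1 - (θ₀ + π * t * ρ)) - (θ₀ + α * t + β * ρ + γ₂ * t * ρ))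
      (π * ρ * (1 - (θ₀ + π * r * ρ)) + (θ₀ + π * r * ρ) * (-(π * ρ)) - (α + γ₂ * ρ)) r := by
  have hu : HasDerivAt (fun t : ℝ => θ₀ + π * t * ρ) (π * ρ) r := by
    have h := (((hasDerivAt_id r).const_mul π).mul_const ρ).const_add θ₀
    simpa using h
  have hv : HasDerivAt (fun t : ℝ => θ₀ + α * t + β * ρ + γ₂ * t * ρ) (α + γ₂ * ρ) r := by
    have e : (fun t : ℝ => θ₀ + α * t + β * ρ + γ₂ * t * ρ) = fun t : ℝ => (θ₀ + β * ρ) + (α + γ₂ * ρ) * t := by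
      funext t; ring
    rw [e]
    have h := ((hasDerivAt_id r).const_mul (α + γ₂ * ρ)).const_add (θ₀ + β * ρ)
    simpa using h
  have hp := hu.mul (hu.const_sub 1)
  exact hp.sub hv

/-- Derivative of the cube polynomial along the second coordinate:
`∂_ρ N(r,ρ) = πr(1 − 2(θ₀ + πrρ)) − β − γ₂r`. [this work] -/
theorem hasDerivAt_snd (θ₀ π α β γ₂ r ρ : ℝ) :
    HasDerivAt (fun t : ℝ => (θ₀ + π * r * t) * (1 - (θ₀ + π * r * t)) - (θ₀ + α * r + β * t + γ₂ * r * t))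
      (π * r * (1 - (θ₀ + π * r * ρ)) + (θ₀ + π * r * ρ) * (-(π * r)) - (β + γ₂ * r)) ρ := by
  have hu : HasDerivAt (fun t : ℝ => θ₀ + π * r * t) (π * r) ρ := by
    have h := ((hasDerivAt_id ρ).const_mul (π * r)).const_add θ₀
    simpa using h
  have hv : HasDerivAt (fun t : ℝ => θ₀ + α * r + β * t + γ₂ * r * t) (β + γ₂ * r) ρ := by
    have e : (fun t : ℝ => θ₀ + α * r + β * t + γ₂ * r * t) = fun t : ℝ => (θ₀ + α * r) + (β + γ₂ * r) * t := by
      funext t; ring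
    rw [e]
    have h := ((hasDerivAt_id ρ).const_mul (β + γ₂ * r)).const_add (θ₀ + α * r)
    simpa using h
  have hp := hu.mul (hu.const_sub 1)
  exact hp.sub hv

/-- **The critical value when `0 ≤ κ` — minimal hypotheses.**  Same as
`ThreePointVarianceTwoNeighbourCore.crit_nonpos_of_kappa_nonneg` but assuming only what its proof uses:
`0 ≤ θ₀`, `0 ≤ π`, `θ₀ + π ≤ 1` and the one-sided bound `α ≥ π − θ₀` (in the graph:
`P_{G/cv − cw}(U) ≥ P_{G/cv/cw}(a↔b) − P_{G−c}(a↔b)`). [this work] -/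
theorem crit_nonpos_of_kappa_nonneg' {θ₀ π α β γ₂ κ r ρ Θ N : ℝ}
    (hθ₀0 : 0 ≤ θ₀) (hπ : 0 ≤ π) (hθπ : θ₀ + π ≤ 1) (hαlb : π - θ₀ ≤ α)
    (hΘ : Θ = θ₀ + π * r * ρ) (hκdef : κ = (1 - 2 * Θ) * π - γ₂)
    (hN : N = Θ * (1 - Θ) - (θ₀ + α * r + β * ρ + γ₂ * r * ρ))
    (hr0 : 0 ≤ r) (hr1 : r ≤ 1) (hρ0 : 0 ≤ ρ) (hρ1 : ρ ≤ 1) (hκ : 0 ≤ κ)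
    (hcrit1 : α = κ * ρ) (hcrit2 : β = κ * r) :
    N ≤ 0 := by
  have hN' : N = Θ ^ 2 - 2 * θ₀ * Θ - α * r := by
    rw [hN]
    linear_combination (-ρ) * hcrit2 + (-(r * ρ)) * hκdef + (1 - 2 * Θ) * hΘ
  rw [hN']
  have hz0 : 0 ≤ r * ρ := mul_nonneg hr0 hρ0
  have hz1 : r * ρ ≤ 1 := by nlinarith
  have hπz : 0 ≤ π * r * ρ := by positivity
  have hπz1 : π * r * ρ ≤ π := by nlinarith [mul_le_mul_of_nonneg_left hz1 hπ]
  have hΘle : Θ ≤ 1 := by rw [hΘ]; linarith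
  have hΘ0 : 0 ≤ Θ := by rw [hΘ]; linarith
  have hα0 : 0 ≤ α := by rw [hcrit1]; exact mul_nonneg hκ hρ0
  have hαr : 0 ≤ α * r := mul_nonneg hα0 hr0
  have eΘ : Θ ^ 2 - 2 * θ₀ * Θ = Θ * (Θ - 2 * θ₀) := by ring
  by_cases hcase : Θ ≤ 2 * θ₀
  · have hA : Θ * (Θ - 2 * θ₀) ≤ 0 := by
      have := mul_nonneg hΘ0 (by linarith : 0 ≤ 2 * θ₀ - Θ)
      linarith
    linarith
  · have hcase' : 2 * θ₀ < Θ := lt_of_not_ge hcase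
    have ew : Θ - 2 * θ₀ = π * r * ρ - θ₀ := by rw [hΘ]; ring
    have hw : 0 ≤ π * r * ρ - θ₀ := by linarith
    have h2 : (π - θ₀) * r ≤ α * r := mul_le_mul_of_nonneg_right hαlb hr0
    have h3 : π * r * ρ - θ₀ ≤ (π - θ₀) * r := by
      have e3 : (π - θ₀) * r - (π * r * ρ - θ₀) = π * r * (1 - ρ) + θ₀ * (1 - r) := by ring
      have t1 : 0 ≤ π * r * (1 - ρ) := mul_nonneg (mul_nonneg hπ hr0) (by linarith)
      have t2 : 0 ≤ θ₀ * (1 - r) := mul_nonneg hθ₀0 (by linarith)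
      linarith
    have h4 : Θ * (Θ - 2 * θ₀) ≤ π * r * ρ - θ₀ := by
      rw [ew]
      exact mul_le_of_le_one_left hw hΘle
    linarith

/-- **`FP₀(2)` — the level-`0` maximum principle for the two-edge cube polynomial.**  With state-law
satisfying only `0 ≤ θ₀`, `0 ≤ π`, `θ₀ + π ≤ 1`, `α ≥ π − θ₀` (`β`, `γ₂` arbitrary; these are what a state
law provides: `θ₀ = P_H(a↔b)`, `π` = crossing mass, `α = P_{G/cv−cw}(U) − θ₀ ≥ π − θ₀`), if
`N(r,ρ) = (θ₀ + πrρ)(1 − θ₀ − πrρ) − (θ₀ + αr + βρ + γ₂rρ)` is `≤ 0` at every boundary point of `[0,1]²`, then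
`N ≤ 0` on all of `[0,1]²`. [this work] -/
theorem fp0_two {θ₀ π α β γ₂ : ℝ} (N : ℝ → ℝ → ℝ)
    (hθ₀0 : 0 ≤ θ₀) (hπ : 0 ≤ π) (hθπ : θ₀ + π ≤ 1) (hαlb : π - θ₀ ≤ α)
    (hN : ∀ r ρ, N r ρ = (θ₀ + π * r * ρ) * (1 - (θ₀ + π * r * ρ)) - (θ₀ + α * r + β * ρ + γ₂ * r * ρ))
    (hbd : ∀ t ∈ Icc (0:ℝ) 1, N t 0 ≤ 0 ∧ N t 1 ≤ 0 ∧ N 0 t ≤ 0 ∧ N 1 t ≤ 0) :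
    ∀ r ∈ Icc (0:ℝ) 1, ∀ ρ ∈ Icc (0:ℝ) 1, N r ρ ≤ 0 := by
  -- extreme value theorem on the square
  set S : Set (ℝ × ℝ) := Icc (0:ℝ) 1 ×ˢ Icc (0:ℝ) 1 with hS
  set F : ℝ × ℝ → ℝ := fun z => N z.1 z.2 with hF
  have hScomp : IsCompact S := isCompact_Icc.prod isCompact_Icc
  have hSne : S.Nonempty := ⟨(0, 0), ⟨⟨le_rfl, zero_le_one⟩, ⟨le_rfl, zero_le_one⟩⟩⟩
  have hFcont : ContinuousOn F S := by
    have hF' : F = fun z : ℝ × ℝ =>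
        (θ₀ + π * z.1 * z.2) * (1 - (θ₀ + π * z.1 * z.2)) - (θ₀ + α * z.1 + β * z.2 + γ₂ * z.1 * z.2) := by
      funext z; simp [hF, hN]
    rw [hF']
    exact Continuous.continuousOn (by fun_prop)
  obtain ⟨z, hzS, hzmax⟩ := hScomp.exists_isMaxOn hSne hFcont
  have hz1 : z.1 ∈ Icc (0:ℝ) 1 := hzS.1
  have hz2 : z.2 ∈ Icc (0:ℝ) 1 := hzS.2
  -- it suffices to bound the maximum
  have hmax : ∀ r ∈ Icc (0:ℝ) 1, ∀ ρ ∈ Icc (0:ℝ) 1, N r ρ ≤ N z.1 z.2 := by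
    intro r hr ρ hρ
    have h := hzmax (show (r, ρ) ∈ S from ⟨hr, hρ⟩)
    simpa [hF] using h
  suffices hz : N z.1 z.2 ≤ 0 by
    intro r hr ρ hρ; exact (hmax r hr ρ hρ).trans hz
  -- boundary maximiser
  by_cases hb : z.1 = 0 ∨ z.1 = 1 ∨ z.2 = 0 ∨ z.2 = 1
  · rcases hb with h | h | h | h
    · rw [h]; exact (hbd z.2 hz2).2.2.1
    · rw [h]; exact (hbd z.2 hz2).2.2.2
    · rw [h]; exact (hbd z.1 hz1).1
    · rw [h]; exact (hbd z.1 hz1).2.1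
  -- interior maximiser: both partial derivatives vanish
  push Not at hb
  obtain ⟨h10, h11, h20, h21⟩ := hb
  have hr0 : 0 < z.1 := lt_of_le_of_ne hz1.1 (Ne.symm h10)
  have hr1 : z.1 < 1 := lt_of_le_of_ne hz1.2 h11
  have hρ0 : 0 < z.2 := lt_of_le_of_ne hz2.1 (Ne.symm h20)
  have hρ1 : z.2 < 1 := lt_of_le_of_ne hz2.2 h21
  set r := z.1 with hr
  set ρ := z.2 with hρ
  -- local maximality along the first coordinate
  have hloc1 : IsLocalMax (fun t : ℝ => (θ₀ + π * t * ρ) * (1 - (θ₀ + π * t * ρ)) -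
      (θ₀ + α * t + β * ρ + γ₂ * t * ρ)) r := by
    have hmem : Icc (0:ℝ) 1 ∈ 𝓝 r := Icc_mem_nhds hr0 hr1
    refine Filter.mem_of_superset hmem ?_
    intro t ht
    have h := hmax t ht ρ hz2
    simp only [mem_setOf_eq]
    rw [← hN t ρ, ← hN r ρ]
    exact h
  have hloc2 : IsLocalMax (fun t : ℝ => (θ₀ + π * r * t) * (1 - (θ₀ + π * r * t)) -
      (θ₀ + α * r + β * t + γ₂ * r * t)) ρ := by
    have hmem : Icc (0:ℝ) 1 ∈ 𝓝 ρ := Icc_mem_nhds hρ0 hρ1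
    refine Filter.mem_of_superset hmem ?_
    intro t ht
    have h := hmax r hz1 t ht
    simp only [mem_setOf_eq]
    rw [← hN r t, ← hN r ρ]
    exact h
  have hD1 := hloc1.hasDerivAt_eq_zero (hasDerivAt_fst θ₀ π α β γ₂ ρ r)
  have hD2 := hloc2.hasDerivAt_eq_zero (hasDerivAt_snd θ₀ π α β γ₂ r ρ)
  -- criticality in the form used by the core: α = κρ, β = κr
  set Θ := θ₀ + π * r * ρ with hΘ
  set κ := (1 - 2 * Θ) * π - γ₂ with hκ
  have hcrit1 : α = κ * ρ := by
    rw [hκ, hΘ]; linarith [hD1]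
  have hcrit2 : β = κ * r := by
    rw [hκ, hΘ]; linarith [hD2]
  have hNz : N r ρ = Θ * (1 - Θ) - (θ₀ + α * r + β * ρ + γ₂ * r * ρ) := by rw [hN r ρ]
  have hN1 : N 1 (r * ρ) = (θ₀ + π * 1 * (r * ρ)) * (1 - (θ₀ + π * 1 * (r * ρ))) -
      (θ₀ + α * 1 + β * (r * ρ) + γ₂ * 1 * (r * ρ)) := hN 1 (r * ρ)
  rcases le_or_gt 0 κ with hκ0 | hκ0
  · exact crit_nonpos_of_kappa_nonneg' hθ₀0 hπ hθπ hαlb hΘ hκ hNz hz1.1 hz1.2 hz2.1 hz2.2 hκ0 hcrit1 hcrit2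
  · have hNz' : N r ρ = (θ₀ + π * r * ρ) * (1 - (θ₀ + π * r * ρ)) - (θ₀ + α * r + β * ρ + γ₂ * r * ρ) := hN r ρ
    have h := crit_le_boundary_of_kappa_nonpos hNz' hN1 hz2.1 hκ0.le hcrit1 hcrit2
    have hzρ : r * ρ ∈ Icc (0:ℝ) 1 := ⟨mul_nonneg hz1.1 hz2.1, by nlinarith [hz1.2, hz2.2, hz1.1, hz2.1]⟩
    exact h.trans (hbd (r * ρ) hzρ).2.2.2

end Summit.CriticalPhenomena.PercolationContinuityZ3.Theorems.ThreePointVarianceTwoNeighbourCube
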